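import Literature.NumberTheory.LFunctions.KloostermanFractionsUntwist
import Literature.NumberTheory.Sieve.DivisorBound
import HarnessLib

/-!
# Bilinear forms with Kloosterman fractions: from (7.1) with the divisor factor to all ranges

Topic `NumberTheory/LFunctions`.  Continuation of `KloostermanFractionsUntwist.lean` for the named
fact `DukeFriedlanderIwaniec1997_bilinearKloostermanFractions` (`DeterminantEquationDFI.lean`)
along S. Bettin, V. Chandee, *Trilinear forms with Kloosterman fractions*, Adv. Math. 328 (2018).
The reduction of §2 of the source to coefficients `β_n` supported on `(n, ϑ) = 1` ("pulling out
the common factor between `n` and `ϑ` and applying the Cauchy–Schwarz inequality", the tree's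
`DFI_bilinear_bound_of_coprime_case`) costs a factor `τ(|k|)^{1/2}`, and the amplification needs
`L > 2 log(bϑM)`, i.e. logarithms of the numerator.  This file PROVES that a bound of the shape of
(7.1) in the range `M ≥ N` carrying the extra factors `τ(|k|)^{1/2} (1 + |k|)^ε` still gives the
named fact: these factors are `≪ |k|^{ε/8}`, and the Bettin–Chandee bound is only ever invoked for
`|k| < (M+N)^{8/3}` (elsewhere the trivial bound wins), where `|k|^{ε/8} ≤ (M+N)^{ε/3}`.

* `DFI_sqrt_tau_le` — `τ(|k|)^{1/2} ≤ C_η |k|^η`;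
* `DFI_shape_of_BC34R_and_trivial` — the range bookkeeping with hypothesis
  `K F R^{ε/4}(1 + R/MN)^{3/4}((MN)^{7/20+ε/8}(M+N)^{1/4} + (MN)^{3/8+ε/8}(M+N)^{1/8})`;
* **`DFI_untwisted_allMN_of_BC71tau_MgeN`**, **`DukeFriedlanderIwaniec1997_bilinearKloostermanFractions_of_BC71tau_MgeN`**
  — hypothesis: for `1/2 ≤ N ≤ M`, `k ≠ 0`, all `α, β` in the boxes,
  `|∑∑_{(m,n)=1} α_m β_n e(k m̄/n)| ≤ K τ(|k|)^{1/2}(1+|k|)^ε ‖α‖‖β‖ (MN)^ε (1 + |k|/MN)^{1/4}(M^{1/2}N^{3/8} + M^{3/5}N^{7/20})`;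
  conclusion: the named fact.

## References

* S. Bettin, V. Chandee, Adv. Math. 328 (2018) 1234–1262 (arXiv:1502.00769), §§2, 7.
  [BettinChandee2018]
* W. Duke, J. Friedlander, H. Iwaniec, Invent. Math. 128 (1997) 23–43, Theorem 2.
  [DukeFriedlanderIwaniec1997]
-/

noncomputable section

open Finset Real Complex

namespace Literature.NumberTheory.LFunctions

/-- `τ(|k|)^{1/2} ≤ C_η |k|^η` for `k ≠ 0` (the divisor bound). [folklore] -/
theorem DFI_sqrt_tau_le {η : ℝ} (hη : 0 < η) :
    ∃ C : ℝ, 0 < C ∧ ∀ k : ℤ, k ≠ 0 →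
      Real.sqrt (k.natAbs.divisors.card : ℝ) ≤ C * |(k : ℝ)| ^ η := by
  obtain ⟨C₁, hC₁1, hC₁⟩ :=
    Literature.NumberTheory.Sieve.exists_card_divisors_le_mul_rpow (ε := 2 * η) (by positivity)
  refine ⟨Real.sqrt C₁, Real.sqrt_pos.mpr (by linarith), fun k hk => ?_⟩
  have h1 := hC₁ k.natAbs (Int.natAbs_ne_zero.mpr hk)
  have habs : ((k.natAbs : ℕ) : ℝ) = |(k : ℝ)| := by
    rw [Nat.cast_natAbs, Int.cast_abs]
  rw [habs] at h1
  have h0 : 0 ≤ |(k : ℝ)| := abs_nonneg _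
  calc Real.sqrt (k.natAbs.divisors.card : ℝ) ≤ Real.sqrt (C₁ * |(k : ℝ)| ^ (2 * η)) :=
        Real.sqrt_le_sqrt h1
    _ = Real.sqrt C₁ * |(k : ℝ)| ^ η := by
        rw [Real.sqrt_mul (by linarith), Real.sqrt_eq_rpow (|(k : ℝ)| ^ (2 * η)),
          ← Real.rpow_mul h0, show 2 * η * (1 / 2) = η by ring]

/-- **Range bookkeeping, final form** (exponent `3/4` and a factor `R^{ε/4}` from `τ(|k|)^{1/2}`
and `(1+|k|)^{ε'}`): if `B ≤ 2(MN)^{1/2}F` and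
`B ≤ K F R^{ε/4} (1 + R/MN)^{3/4} ((MN)^{7/20+ε/8}(M+N)^{1/4} + (MN)^{3/8+ε/8}(M+N)^{1/8})`
then `B ≤ (2 + 8K) F (R + MN)^{3/8}(M+N)^{11/48+ε}` (`M, N ≥ 1/2`, `R ≥ 1`).  In the two ranges
where the second bound is used one has `R ≤ MN ≤ (M+N)²`, resp. `R < (M+N)^{8/3}`, so `R^{ε/4}`
is absorbed. [folklore] -/
theorem DFI_shape_of_BC34R_and_trivial {ε K M N R F B : ℝ} (hε : 0 < ε) (hK : 0 < K)
    (hM : 1 / 2 ≤ M) (hN : 1 / 2 ≤ N) (hR : 1 ≤ R) (hF : 0 ≤ F)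
    (htriv : B ≤ 2 * Real.sqrt (M * N) * F)
    (hBC : B ≤ K * F * R ^ (ε / 4) * (1 + R / (M * N)) ^ (3 / 4 : ℝ) *
      ((M * N) ^ (7 / 20 + ε / 8) * (M + N) ^ (1 / 4 : ℝ) +
        (M * N) ^ (3 / 8 + ε / 8) * (M + N) ^ (1 / 8 : ℝ))) :
    B ≤ (2 + 8 * K) * F * (R + M * N) ^ (3 / 8 : ℝ) * (M + N) ^ (11 / 48 + ε) := by
  have hM0 : 0 < M := by linarith
  have hN0 : 0 < N := by linarith
  have hQ0 : 0 < M * N := mul_pos hM0 hN0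
  have hP1 : 1 ≤ M + N := by linarith
  have hP0 : 0 < M + N := by linarith
  have hR0 : 0 < R := by linarith
  obtain ⟨q, hq⟩ : ∃ q : ℝ, q = Real.log (M * N) := ⟨_, rfl⟩
  obtain ⟨p, hp⟩ : ∃ p : ℝ, p = Real.log (M + N) := ⟨_, rfl⟩
  obtain ⟨r, hr⟩ : ∃ r : ℝ, r = Real.log R := ⟨_, rfl⟩
  have hp0 : 0 ≤ p := hp ▸ Real.log_nonneg hP1
  have hr0 : 0 ≤ r := hr ▸ Real.log_nonneg hR
  have hqp : q ≤ 2 * p := by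
    have h1 : M * N ≤ (M + N) ^ 2 := by nlinarith [sq_nonneg (M - N)]
    have h2 : Real.log (M * N) ≤ Real.log ((M + N) ^ 2) := Real.log_le_log hQ0 h1
    rw [Real.log_pow, ← hq, ← hp] at h2
    push_cast at h2
    linarith
  have hlog4 : Real.log 4 ≤ 2 := by
    have h2 : Real.log 4 = 2 * Real.log 2 := by
      rw [show (4 : ℝ) = 2 ^ 2 by norm_num, Real.log_pow]; push_cast; ring
    rw [h2]
    have := Real.log_two_lt_d9
    linarith
  have hpq : p - 2 ≤ q := by
    have h1 : (M + N) / 4 ≤ M * N := by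
      rcases le_total M N with h | h
      · nlinarith
      · nlinarith
    have h2 : Real.log ((M + N) / 4) ≤ Real.log (M * N) := Real.log_le_log (by positivity) h1
    rw [Real.log_div hP0.ne' (by norm_num), ← hp, ← hq] at h2
    linarith
  have hεq : ε / 8 * q ≤ ε / 4 * p := by
    have := mul_le_mul_of_nonneg_left hqp (by positivity : (0 : ℝ) ≤ ε / 8)
    linarith
  have hεp : 0 ≤ ε * p := mul_nonneg hε.le hp0
  have eQ : ∀ a : ℝ, (M * N) ^ a = Real.exp (a * q) := fun a => by
    rw [Real.rpow_def_of_pos hQ0, mul_comm, hq]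
  have eP : ∀ a : ℝ, (M + N) ^ a = Real.exp (a * p) := fun a => by
    rw [Real.rpow_def_of_pos hP0, mul_comm, hp]
  have eR : ∀ a : ℝ, R ^ a = Real.exp (a * r) := fun a => by
    rw [Real.rpow_def_of_pos hR0, mul_comm, hr]
  have esqrt : Real.sqrt (M * N) = Real.exp (1 / 2 * q) := by
    rw [Real.sqrt_eq_rpow, eQ]
  set G : ℝ := (R + M * N) ^ (3 / 8 : ℝ) * (M + N) ^ (11 / 48 + ε) with hG
  have hG_r : Real.exp (3 / 8 * r + (11 / 48 + ε) * p) ≤ G := by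
    rw [Real.exp_add, hG, ← eR, ← eP]
    gcongr
    linarith
  have hG_q : Real.exp (3 / 8 * q + (11 / 48 + ε) * p) ≤ G := by
    rw [Real.exp_add, hG, ← eQ, ← eP]
    gcongr
    linarith
  have hKF : 0 ≤ K * F := mul_nonneg hK.le hF
  have h234 : (2 : ℝ) ^ (3 / 4 : ℝ) ≤ 2 := by
    calc (2 : ℝ) ^ (3 / 4 : ℝ) ≤ (2 : ℝ) ^ (1 : ℝ) :=
          Real.rpow_le_rpow_of_exponent_le (by norm_num) (by norm_num)
      _ = 2 := Real.rpow_one 2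
  have hexp : Real.exp (1 / 20) ≤ 3 := by
    have h1 : Real.exp (1 / 20) ≤ Real.exp 1 := Real.exp_le_exp.mpr (by norm_num)
    have h2 := Real.exp_one_lt_d9
    linarith
  have eT : (M * N) ^ (7 / 20 + ε / 8) * (M + N) ^ (1 / 4 : ℝ) +
      (M * N) ^ (3 / 8 + ε / 8) * (M + N) ^ (1 / 8 : ℝ) =
      Real.exp ((7 / 20 + ε / 8) * q + 1 / 4 * p) + Real.exp ((3 / 8 + ε / 8) * q + 1 / 8 * p) := by
    rw [eQ, eP, eQ, eP, ← Real.exp_add, ← Real.exp_add]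
  rw [eT, eR] at hBC
  by_cases h1 : R ≤ M * N
  · -- Case `R ≤ MN`: then `r ≤ q ≤ 2p`
    have hrq : r ≤ q := by rw [hr, hq]; exact Real.log_le_log hR0 h1
    have hηr : ε / 4 * r ≤ ε / 2 * p := by
      have : r ≤ 2 * p := hrq.trans hqp
      have := mul_le_mul_of_nonneg_left this (by positivity : (0 : ℝ) ≤ ε / 4)
      linarith
    have hfac : (1 + R / (M * N)) ^ (3 / 4 : ℝ) ≤ 2 := by
      have h2 : 1 + R / (M * N) ≤ 2 := by
        have h3 : R / (M * N) ≤ 1 := (div_le_one hQ0).mpr h1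
        linarith only [h3]
      exact (Real.rpow_le_rpow (by positivity) h2 (by norm_num)).trans h234
    set X : ℝ := Real.exp (3 / 8 * q + (11 / 48 + ε) * p) with hX
    have hX0 : 0 ≤ X := (Real.exp_pos _).le
    have hT₁ : Real.exp (ε / 4 * r) * Real.exp ((7 / 20 + ε / 8) * q + 1 / 4 * p) ≤
        Real.exp (1 / 20) * X := by
      rw [← Real.exp_add, ← Real.exp_add]
      exact Real.exp_le_exp.mpr (by linarith only [hpq, hεq, hp0, hεp, hηr])
    have hT₂ : Real.exp (ε / 4 * r) * Real.exp ((3 / 8 + ε / 8) * q + 1 / 8 * p) ≤ X := by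
      rw [← Real.exp_add]
      exact Real.exp_le_exp.mpr (by linarith only [hεq, hp0, hεp, hηr])
    calc B ≤ K * F * Real.exp (ε / 4 * r) * (1 + R / (M * N)) ^ (3 / 4 : ℝ) *
          (Real.exp ((7 / 20 + ε / 8) * q + 1 / 4 * p) +
            Real.exp ((3 / 8 + ε / 8) * q + 1 / 8 * p)) := hBC
      _ ≤ K * F * Real.exp (ε / 4 * r) * 2 *
          (Real.exp ((7 / 20 + ε / 8) * q + 1 / 4 * p) +
            Real.exp ((3 / 8 + ε / 8) * q + 1 / 8 * p)) := by gcongr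
      _ = K * F * 2 * (Real.exp (ε / 4 * r) * Real.exp ((7 / 20 + ε / 8) * q + 1 / 4 * p) +
            Real.exp (ε / 4 * r) * Real.exp ((3 / 8 + ε / 8) * q + 1 / 8 * p)) := by ring
      _ ≤ K * F * 2 * (Real.exp (1 / 20) * X + X) := by gcongr
      _ ≤ K * F * 2 * (3 * X + X) := by gcongr
      _ = 8 * (K * F) * X := by ring
      _ ≤ (2 + 8 * K) * F * X := by
          linarith only [mul_nonneg hKF hX0, mul_nonneg hF hX0]
      _ ≤ (2 + 8 * K) * F * G := by gcongr
      _ = _ := by rw [hG]; ring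
  · have h1' : M * N < R := not_le.mp h1
    have hqr : q ≤ r := by
      rw [hq, hr]; exact Real.log_le_log hQ0 h1'.le
    by_cases h2 : 1 / 2 * q ≤ 3 / 8 * r + 11 / 48 * p
    · calc B ≤ 2 * Real.sqrt (M * N) * F := htriv
        _ = 2 * F * Real.exp (1 / 2 * q) := by rw [esqrt]; ring
        _ ≤ 2 * F * Real.exp (3 / 8 * r + (11 / 48 + ε) * p) := by
            gcongr 2 * F * ?_
            exact Real.exp_le_exp.mpr (by linarith only [h2, hεp])
        _ ≤ 2 * F * G := by gcongr
        _ ≤ (2 + 8 * K) * F * G := by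
            have h3 : 0 ≤ F * G := mul_nonneg hF (by positivity)
            have h4 : 0 ≤ K * (F * G) := mul_nonneg hK.le h3
            linarith only [h3, h4]
        _ = _ := by rw [hG]; ring
    · have h2' : 3 / 8 * r + 11 / 48 * p < 1 / 2 * q := not_le.mp h2
      -- here `r < (8/3) p`
      have hηr : ε / 4 * r ≤ 2 * ε / 3 * p := by
        have h3 : r ≤ 8 / 3 * p := by linarith only [h2', hqp, hp0]
        have := mul_le_mul_of_nonneg_left h3 (by positivity : (0 : ℝ) ≤ ε / 4)
        linarith
      have hfac : (1 + R / (M * N)) ^ (3 / 4 : ℝ) ≤ 2 * Real.exp (3 / 4 * (r - q)) := by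
        have hRQ : R / (M * N) = Real.exp (r - q) := by
          rw [Real.exp_sub, hr, hq, Real.exp_log hR0, Real.exp_log hQ0]
        have h3 : 1 + R / (M * N) ≤ 2 * Real.exp (r - q) := by
          have h4 : 1 ≤ Real.exp (r - q) := Real.one_le_exp (by linarith only [hqr])
          rw [hRQ]; linarith only [h4]
        calc (1 + R / (M * N)) ^ (3 / 4 : ℝ) ≤ (2 * Real.exp (r - q)) ^ (3 / 4 : ℝ) :=
              Real.rpow_le_rpow (by positivity) h3 (by norm_num)
          _ = (2 : ℝ) ^ (3 / 4 : ℝ) * Real.exp (3 / 4 * (r - q)) := by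
              rw [Real.mul_rpow (by norm_num) (Real.exp_pos _).le, ← Real.exp_mul, mul_comm (r - q)]
          _ ≤ 2 * Real.exp (3 / 4 * (r - q)) := by gcongr
      set X : ℝ := Real.exp (3 / 8 * r + (11 / 48 + ε) * p) with hX
      have hX0 : 0 ≤ X := (Real.exp_pos _).le
      have hT₁ : Real.exp (ε / 4 * r) * Real.exp (3 / 4 * (r - q)) *
          Real.exp ((7 / 20 + ε / 8) * q + 1 / 4 * p) ≤ X := by
        rw [← Real.exp_add, ← Real.exp_add]
        exact Real.exp_le_exp.mpr (by linarith only [h2', hεq, hqp, hp0, hεp, hηr])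
      have hT₂ : Real.exp (ε / 4 * r) * Real.exp (3 / 4 * (r - q)) *
          Real.exp ((3 / 8 + ε / 8) * q + 1 / 8 * p) ≤ X := by
        rw [← Real.exp_add, ← Real.exp_add]
        exact Real.exp_le_exp.mpr (by linarith only [h2', hεq, hqp, hp0, hεp, hηr])
      calc B ≤ K * F * Real.exp (ε / 4 * r) * (1 + R / (M * N)) ^ (3 / 4 : ℝ) *
            (Real.exp ((7 / 20 + ε / 8) * q + 1 / 4 * p) +
              Real.exp ((3 / 8 + ε / 8) * q + 1 / 8 * p)) := hBC
        _ ≤ K * F * Real.exp (ε / 4 * r) * (2 * Real.exp (3 / 4 * (r - q))) *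
            (Real.exp ((7 / 20 + ε / 8) * q + 1 / 4 * p) +
              Real.exp ((3 / 8 + ε / 8) * q + 1 / 8 * p)) := by gcongr
        _ = K * F * 2 *
            (Real.exp (ε / 4 * r) * Real.exp (3 / 4 * (r - q)) *
                Real.exp ((7 / 20 + ε / 8) * q + 1 / 4 * p) +
              Real.exp (ε / 4 * r) * Real.exp (3 / 4 * (r - q)) *
                Real.exp ((3 / 8 + ε / 8) * q + 1 / 8 * p)) := by ring
        _ ≤ K * F * 2 * (X + X) := by gcongr
        _ = 4 * (K * F) * X := by ring
        _ ≤ (2 + 8 * K) * F * X := by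
            linarith only [mul_nonneg hKF hX0, mul_nonneg hF hX0]
        _ ≤ (2 + 8 * K) * F * G := by gcongr
        _ = _ := by rw [hG]; ring

/-- `x^{ε/16} ≤ 4^{ε/16} x^{ε/8}` for `x ≥ 1/4` (used with `x = MN`). [folklore] -/
theorem DFI_rpow_sixteenth_le {x ε : ℝ} (hx : 1 / 4 ≤ x) (hε : 0 ≤ ε) :
    x ^ (ε / 16) ≤ (4 : ℝ) ^ (ε / 16) * x ^ (ε / 8) := by
  have hx0 : 0 < x := by linarith
  have h1 : x ^ (ε / 16) = x ^ (ε / 8) * x ^ (-(ε / 16)) := by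
    rw [← Real.rpow_add hx0]; ring_nf
  have h2 : x ^ (-(ε / 16)) ≤ (1 / 4 : ℝ) ^ (-(ε / 16)) :=
    Real.rpow_le_rpow_of_nonpos (by norm_num) hx (by linarith)
  have h3 : (1 / 4 : ℝ) ^ (-(ε / 16)) = (4 : ℝ) ^ (ε / 16) := by
    rw [Real.div_rpow zero_le_one (by norm_num), Real.one_rpow, Real.rpow_neg (by norm_num), one_div,
      inv_inv]
  calc x ^ (ε / 16) = x ^ (ε / 8) * x ^ (-(ε / 16)) := h1
    _ ≤ x ^ (ε / 8) * (4 : ℝ) ^ (ε / 16) := by rw [← h3]; gcongr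
    _ = _ := mul_comm _ _

/-- **From (7.1) with the divisor factor and a factor `(1 + |k|)^ε`, range `M ≥ N`, to all
ranges.**  As `DFI_untwisted_allMN_of_BC71_MgeN`, but the hypothesis may carry the factor
`τ(|k|)^{1/2}` produced by the reduction to coefficients coprime to `k`
(`DFI_bilinear_bound_of_coprime_case`) and a factor `(1 + |k|)^ε` (so that logarithms of the
numerator arising in the amplification, "`L > 2 log(bϑM)`", need not be tracked): for every
`ε > 0` there is `K` with, for `1/2 ≤ N ≤ M`, `k ≠ 0`, all `α`, `β` in the boxes,
`|∑∑_{(m,n)=1} α_m β_n e(k m̄/n)| ≤ K τ(|k|)^{1/2} (1+|k|)^ε ‖α‖‖β‖ (MN)^ε (1 + |k|/MN)^{1/4} (M^{1/2}N^{3/8} + M^{3/5}N^{7/20})`.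
Then the untwisted Duke–Friedlander–Iwaniec bound holds in all ranges (`τ(|k|)^{1/2}(1+|k|)^{ε/16} ≪ |k|^{ε/8}`
is absorbed by `DFI_shape_of_BC34R_and_trivial`, since that bound is only invoked for
`|k| < (M+N)^{8/3}`). [cite: BettinChandee2018, §7] [cite: DukeFriedlanderIwaniec1997, Theorem 2] -/
theorem DFI_untwisted_allMN_of_BC71tau_MgeN
    (h : ∀ ε : ℝ, 0 < ε → ∃ K : ℝ, 0 < K ∧
      ∀ (M N : ℝ), 1 / 2 ≤ N → N ≤ M → ∀ (k : ℤ), k ≠ 0 → ∀ (α β : ℕ → ℂ),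
        (∀ m : ℕ, α m ≠ 0 → M < m ∧ (m : ℝ) ≤ 2 * M) →
        (∀ n : ℕ, β n ≠ 0 → N < n ∧ (n : ℝ) ≤ 2 * N) →
        ‖∑ m ∈ Icc 1 ⌊2 * M⌋₊, ∑ n ∈ Icc 1 ⌊2 * N⌋₊,
            if m.Coprime n then
              α m * β n * Complex.exp (2 * Real.pi * Complex.I *
                ((k : ℂ) * ((((m : ZMod n)⁻¹).val : ℕ) : ℂ) / (n : ℂ)))
            else 0‖ ≤
          K * Real.sqrt (k.natAbs.divisors.card : ℝ) * (1 + |(k : ℝ)|) ^ ε *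
            Real.sqrt (∑ m ∈ Icc 1 ⌊2 * M⌋₊, ‖α m‖ ^ 2) *
            Real.sqrt (∑ n ∈ Icc 1 ⌊2 * N⌋₊, ‖β n‖ ^ 2) * (M * N) ^ ε *
            (1 + |(k : ℝ)| / (M * N)) ^ (1 / 4 : ℝ) *
            (M ^ (1 / 2 : ℝ) * N ^ (3 / 8 : ℝ) + M ^ (3 / 5 : ℝ) * N ^ (7 / 20 : ℝ))) :
    ∀ ε : ℝ, 0 < ε → ∃ K : ℝ, 0 < K ∧
      ∀ (M N : ℝ), 1 / 2 ≤ M → 1 / 2 ≤ N → ∀ (k : ℤ), k ≠ 0 → ∀ (α β : ℕ → ℂ),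
        (∀ m : ℕ, α m ≠ 0 → M < m ∧ (m : ℝ) ≤ 2 * M) →
        (∀ n : ℕ, β n ≠ 0 → N < n ∧ (n : ℝ) ≤ 2 * N) →
        ‖∑ m ∈ Icc 1 ⌊2 * M⌋₊, ∑ n ∈ Icc 1 ⌊2 * N⌋₊,
            if m.Coprime n then
              α m * β n * Complex.exp (2 * Real.pi * Complex.I *
                ((k : ℂ) * ((((m : ZMod n)⁻¹).val : ℕ) : ℂ) / (n : ℂ)))
            else 0‖ ≤
          K * Real.sqrt (∑ m ∈ Icc 1 ⌊2 * M⌋₊, ‖α m‖ ^ 2) *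
            Real.sqrt (∑ n ∈ Icc 1 ⌊2 * N⌋₊, ‖β n‖ ^ 2) *
            (|(k : ℝ)| + M * N) ^ (3 / 8 : ℝ) * (M + N) ^ (11 / 48 + ε) := by
  intro ε hε
  obtain ⟨K, hK, hB⟩ := h (ε / 16) (by positivity)
  obtain ⟨Cτ, hCτ, hτ⟩ := DFI_sqrt_tau_le (η := ε / 16) (by positivity)
  -- the constant absorbing `2^{ε/16}` (from `1 + |k| ≤ 2|k|`) and `4^{ε/16}` (from `MN ≥ 1/4`)
  set A : ℝ := (2 : ℝ) ^ (ε / 16) * (4 : ℝ) ^ (ε / 16) with hA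
  have hA0 : 0 < A := by positivity
  set K₂ : ℝ := 2 * Real.exp (2 * π) * K * Cτ * A with hK₂
  have hK₂0 : 0 < K₂ := by positivity
  have hKK₂ : K * Cτ * A ≤ K₂ := by
    have h1 : 1 ≤ 2 * Real.exp (2 * π) := by
      have := Real.add_one_le_exp (2 * π)
      have : 0 < 2 * π := by positivity
      linarith
    calc K * Cτ * A = 1 * (K * Cτ * A) := (one_mul _).symm
      _ ≤ 2 * Real.exp (2 * π) * (K * Cτ * A) := by gcongr
      _ = K₂ := by rw [hK₂]; ring
  refine ⟨2 + 8 * K₂, by positivity, ?_⟩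
  intro M N hM hN k hk α β hα hβ
  have hM0 : 0 < M := by linarith
  have hN0 : 0 < N := by linarith
  have hQ4 : 1 / 4 ≤ M * N := by nlinarith
  have hR : (1 : ℝ) ≤ |(k : ℝ)| := by
    rw [← Int.cast_abs]; exact_mod_cast Int.one_le_abs hk
  have hR0 : (0 : ℝ) < |(k : ℝ)| := by linarith
  have htriv := DFI_bilinear_trivial_bound hM0.le hN0.le k α β
  set nα := Real.sqrt (∑ m ∈ Icc 1 ⌊2 * M⌋₊, ‖α m‖ ^ 2) with hnα
  set nβ := Real.sqrt (∑ n ∈ Icc 1 ⌊2 * N⌋₊, ‖β n‖ ^ 2) with hnβ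
  set B := ‖∑ m ∈ Icc 1 ⌊2 * M⌋₊, ∑ n ∈ Icc 1 ⌊2 * N⌋₊,
    if m.Coprime n then
      α m * β n * Complex.exp (2 * Real.pi * Complex.I *
        ((k : ℂ) * ((((m : ZMod n)⁻¹).val : ℕ) : ℂ) / (n : ℂ)))
    else 0‖ with hBdef
  have hnα0 : 0 ≤ nα := Real.sqrt_nonneg _
  have hnβ0 : 0 ≤ nβ := Real.sqrt_nonneg _
  set W : ℝ := 1 + |(k : ℝ)| / (M * N) with hW
  have hW1 : 1 ≤ W := by
    have h0 : 0 ≤ |(k : ℝ)| / (M * N) := by positivity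
    show 1 ≤ 1 + |(k : ℝ)| / (M * N)
    exact le_add_of_nonneg_right h0
  -- the numerator factors: `τ(|k|)^{1/2} (1 + |k|)^{ε/16} ≤ Cτ 2^{ε/16} |k|^{ε/8} ≤ Cτ 2^{ε/16} |k|^{ε/4}`
  set τk : ℝ := Real.sqrt (k.natAbs.divisors.card : ℝ) with hτk
  have hτk0 : 0 ≤ τk := Real.sqrt_nonneg _
  set Rη : ℝ := |(k : ℝ)| ^ (ε / 4) with hRη
  have hnum : τk * (1 + |(k : ℝ)|) ^ (ε / 16) ≤ Cτ * (2 : ℝ) ^ (ε / 16) * Rη := by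
    have h1 : τk ≤ Cτ * |(k : ℝ)| ^ (ε / 16) := hτ k hk
    have h2 : (1 + |(k : ℝ)|) ^ (ε / 16) ≤ (2 : ℝ) ^ (ε / 16) * |(k : ℝ)| ^ (ε / 16) := by
      rw [← Real.mul_rpow (by norm_num) hR0.le]
      exact Real.rpow_le_rpow (by positivity) (by linarith) (by positivity)
    have h3 : |(k : ℝ)| ^ (ε / 16) * |(k : ℝ)| ^ (ε / 16) = |(k : ℝ)| ^ (ε / 8) := by
      rw [← Real.rpow_add hR0]; ring_nf
    have h4 : |(k : ℝ)| ^ (ε / 8) ≤ Rη := by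
      rw [hRη]; exact Real.rpow_le_rpow_of_exponent_le hR (by linarith)
    calc τk * (1 + |(k : ℝ)|) ^ (ε / 16)
        ≤ (Cτ * |(k : ℝ)| ^ (ε / 16)) * ((2 : ℝ) ^ (ε / 16) * |(k : ℝ)| ^ (ε / 16)) := by
          gcongr
      _ = Cτ * (2 : ℝ) ^ (ε / 16) * (|(k : ℝ)| ^ (ε / 16) * |(k : ℝ)| ^ (ε / 16)) := by ring
      _ ≤ Cτ * (2 : ℝ) ^ (ε / 16) * Rη := by rw [h3]; gcongr
  -- `(MN)^{ε/16} ≤ 4^{ε/16} (MN)^{ε/8}`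
  have hQε : (M * N) ^ (ε / 16) ≤ (4 : ℝ) ^ (ε / 16) * (M * N) ^ (ε / 8) :=
    DFI_rpow_sixteenth_le hQ4 hε.le
  set RHS : ℝ := (M * N) ^ (7 / 20 + ε / 8) * (M + N) ^ (1 / 4 : ℝ) +
    (M * N) ^ (3 / 8 + ε / 8) * (M + N) ^ (1 / 8 : ℝ) with hRHS
  have hRHS0 : 0 ≤ RHS := by positivity
  -- Bettin–Chandee shape with exponent 3/4 and the factor `Rη`, in both ranges
  have hBC34 : B ≤ K₂ * (nα * nβ) * Rη * W ^ (3 / 4 : ℝ) * RHS := by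
    rcases le_or_gt N M with hNM | hMN
    · have h1 := hB M N hN hNM k hk α β hα hβ
      have h72 := DFI_terms72_le (ε / 8) hM0 hN0
      have hW14 : W ^ (1 / 4 : ℝ) ≤ W ^ (3 / 4 : ℝ) := DFI_rpow_quarter_le_three_quarters hW1
      calc B ≤ _ := h1
        _ = K * (τk * (1 + |(k : ℝ)|) ^ (ε / 16)) * (nα * nβ) * (M * N) ^ (ε / 16) * W ^ (1 / 4 : ℝ) *
            (M ^ (1 / 2 : ℝ) * N ^ (3 / 8 : ℝ) + M ^ (3 / 5 : ℝ) * N ^ (7 / 20 : ℝ)) := by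
            rw [hW, hτk]; ring
        _ ≤ K * (Cτ * (2 : ℝ) ^ (ε / 16) * Rη) * (nα * nβ) * ((4 : ℝ) ^ (ε / 16) * (M * N) ^ (ε / 8)) *
            W ^ (3 / 4 : ℝ) * (M ^ (1 / 2 : ℝ) * N ^ (3 / 8 : ℝ) + M ^ (3 / 5 : ℝ) * N ^ (7 / 20 : ℝ)) := by
            gcongr
        _ = (K * Cτ * A) * (nα * nβ) * Rη * W ^ (3 / 4 : ℝ) *
            ((M * N) ^ (ε / 8) * (M ^ (1 / 2 : ℝ) * N ^ (3 / 8 : ℝ) + M ^ (3 / 5 : ℝ) * N ^ (7 / 20 : ℝ))) := by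
            rw [hA]; ring
        _ ≤ K₂ * (nα * nβ) * Rη * W ^ (3 / 4 : ℝ) * RHS := by gcongr
    · rw [hBdef, DFI_bilinear_eq_swap]
      have hk' : (-k : ℤ) ≠ 0 := neg_ne_zero.mpr hk
      have habs : |((-k : ℤ) : ℝ)| = |(k : ℝ)| := by rw [Int.cast_neg, abs_neg]
      have hτ' : ((-k : ℤ)).natAbs = k.natAbs := Int.natAbs_neg k
      have hB' : ∀ (α' β' : ℕ → ℂ),
          (∀ m : ℕ, α' m ≠ 0 → N < m ∧ (m : ℝ) ≤ 2 * N) →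
          (∀ n : ℕ, β' n ≠ 0 → M < n ∧ (n : ℝ) ≤ 2 * M) →
          ‖∑ m ∈ Finset.Icc 1 ⌊2 * N⌋₊, ∑ n ∈ Finset.Icc 1 ⌊2 * M⌋₊,
              if Nat.Coprime m n then
                α' m * β' n * cexp (2 * π * I *
                  (((-k : ℤ) : ℂ) * ((((m : ZMod n)⁻¹).val : ℕ) : ℂ) / (n : ℂ)))
              else 0‖ ≤
            K * √(∑ m ∈ Finset.Icc 1 ⌊2 * N⌋₊, ‖α' m‖ ^ 2) *
              √(∑ n ∈ Finset.Icc 1 ⌊2 * M⌋₊, ‖β' n‖ ^ 2) *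
              (τk * (1 + |(k : ℝ)|) ^ (ε / 16) * (N * M) ^ (ε / 16) *
                (1 + |(k : ℝ)| / (N * M)) ^ (1 / 4 : ℝ)) *
              (N ^ (1 / 2 : ℝ) * M ^ (3 / 8 : ℝ) + N ^ (3 / 5 : ℝ) * M ^ (7 / 20 : ℝ)) := by
        intro α' β' hα' hβ'
        have h2 := hB N M hM hMN.le (-k) hk' α' β' hα' hβ'
        rw [habs, hτ'] at h2
        calc _ ≤ _ := h2
          _ = _ := by rw [hτk]; ring
      have hP₁ : 0 ≤ τk * (1 + |(k : ℝ)|) ^ (ε / 16) * (N * M) ^ (ε / 16) *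
          (1 + |(k : ℝ)| / (N * M)) ^ (1 / 4 : ℝ) := by positivity
      have hP₂ : 0 ≤ N ^ (1 / 2 : ℝ) * M ^ (3 / 8 : ℝ) + N ^ (3 / 5 : ℝ) * M ^ (7 / 20 : ℝ) := by
        positivity
      have h3 := DFI_twisted_le_of_untwisted hN hM hK.le hP₁ hP₂ hB' (k : ℝ) β α hβ hα
      have h72 := DFI_terms72_le (ε / 8) hN0 hM0
      rw [mul_comm N M, add_comm N M] at h72
      have hW34 : (1 + |((k : ℝ))| / (N * M)) ^ (1 / 2 : ℝ) * (1 + |(k : ℝ)| / (N * M)) ^ (1 / 4 : ℝ) =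
          W ^ (3 / 4 : ℝ) := by
        rw [mul_comm N M, ← hW, ← Real.rpow_add (by linarith)]
        norm_num
      calc _ ≤ _ := h3
        _ = 2 * Real.exp (2 * π) * K * (nα * nβ) * (τk * (1 + |(k : ℝ)|) ^ (ε / 16)) *
            ((1 + |((k : ℝ))| / (N * M)) ^ (1 / 2 : ℝ) * (1 + |(k : ℝ)| / (N * M)) ^ (1 / 4 : ℝ)) *
            (N * M) ^ (ε / 16) * (N ^ (1 / 2 : ℝ) * M ^ (3 / 8 : ℝ) + N ^ (3 / 5 : ℝ) * M ^ (7 / 20 : ℝ)) := by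
            ring
        _ = 2 * Real.exp (2 * π) * K * (nα * nβ) * (τk * (1 + |(k : ℝ)|) ^ (ε / 16)) * W ^ (3 / 4 : ℝ) *
            (N * M) ^ (ε / 16) * (N ^ (1 / 2 : ℝ) * M ^ (3 / 8 : ℝ) + N ^ (3 / 5 : ℝ) * M ^ (7 / 20 : ℝ)) := by
            rw [hW34]
        _ ≤ 2 * Real.exp (2 * π) * K * (nα * nβ) * (Cτ * (2 : ℝ) ^ (ε / 16) * Rη) * W ^ (3 / 4 : ℝ) *
            ((4 : ℝ) ^ (ε / 16) * (M * N) ^ (ε / 8)) *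
            (N ^ (1 / 2 : ℝ) * M ^ (3 / 8 : ℝ) + N ^ (3 / 5 : ℝ) * M ^ (7 / 20 : ℝ)) := by
            rw [mul_comm N M]
            gcongr
        _ = K₂ * (nα * nβ) * Rη * W ^ (3 / 4 : ℝ) *
            ((M * N) ^ (ε / 8) * (N ^ (1 / 2 : ℝ) * M ^ (3 / 8 : ℝ) + N ^ (3 / 5 : ℝ) * M ^ (7 / 20 : ℝ))) := by
            rw [hK₂, hA]; ring
        _ ≤ K₂ * (nα * nβ) * Rη * W ^ (3 / 4 : ℝ) * RHS := by gcongr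
  have htriv' : B ≤ 2 * Real.sqrt (M * N) * (nα * nβ) := by
    calc B ≤ _ := htriv
      _ = _ := by ring
  have hBC' : B ≤ K₂ * (nα * nβ) * |(k : ℝ)| ^ (ε / 4) * (1 + |(k : ℝ)| / (M * N)) ^ (3 / 4 : ℝ) *
      ((M * N) ^ (7 / 20 + ε / 8) * (M + N) ^ (1 / 4 : ℝ) +
        (M * N) ^ (3 / 8 + ε / 8) * (M + N) ^ (1 / 8 : ℝ)) := by
    rw [hRη, hW, hRHS] at hBC34; exact hBC34
  have hmain := DFI_shape_of_BC34R_and_trivial hε hK₂0 hM hN hR (mul_nonneg hnα0 hnβ0) htriv' hBC'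
  calc B ≤ _ := hmain
    _ = _ := by ring

/-- **The named fact from (7.1) with the factors `τ(|k|)^{1/2}(1+|k|)^ε`, untwisted, in the
range `M ≥ N`.** [cite: BettinChandee2018, §7] [cite: DukeFriedlanderIwaniec1997, Theorem 2] -/
theorem DukeFriedlanderIwaniec1997_bilinearKloostermanFractions_of_BC71tau_MgeN
    (h : ∀ ε : ℝ, 0 < ε → ∃ K : ℝ, 0 < K ∧
      ∀ (M N : ℝ), 1 / 2 ≤ N → N ≤ M → ∀ (k : ℤ), k ≠ 0 → ∀ (α β : ℕ → ℂ),
        (∀ m : ℕ, α m ≠ 0 → M < m ∧ (m : ℝ) ≤ 2 * M) →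
        (∀ n : ℕ, β n ≠ 0 → N < n ∧ (n : ℝ) ≤ 2 * N) →
        ‖∑ m ∈ Icc 1 ⌊2 * M⌋₊, ∑ n ∈ Icc 1 ⌊2 * N⌋₊,
            if m.Coprime n then
              α m * β n * Complex.exp (2 * Real.pi * Complex.I *
                ((k : ℂ) * ((((m : ZMod n)⁻¹).val : ℕ) : ℂ) / (n : ℂ)))
            else 0‖ ≤
          K * Real.sqrt (k.natAbs.divisors.card : ℝ) * (1 + |(k : ℝ)|) ^ ε *
            Real.sqrt (∑ m ∈ Icc 1 ⌊2 * M⌋₊, ‖α m‖ ^ 2) *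
            Real.sqrt (∑ n ∈ Icc 1 ⌊2 * N⌋₊, ‖β n‖ ^ 2) * (M * N) ^ ε *
            (1 + |(k : ℝ)| / (M * N)) ^ (1 / 4 : ℝ) *
            (M ^ (1 / 2 : ℝ) * N ^ (3 / 8 : ℝ) + M ^ (3 / 5 : ℝ) * N ^ (7 / 20 : ℝ))) :
    DukeFriedlanderIwaniec1997_bilinearKloostermanFractions :=
  DukeFriedlanderIwaniec1997_bilinearKloostermanFractions_of_untwisted
    (DFI_untwisted_allMN_of_BC71tau_MgeN h)

end Literature.NumberTheory.LFunctions

end
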